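import Summits.BirchSwinnertonDyer.Rank1Residual.Additive.GreenbergVatsalTransferCountThree
import Summits.BirchSwinnertonDyer.Rank1Residual.Additive.RamifiedOrdinaryLineUniqueClasses
import Summits.BirchSwinnertonDyer.Rank1Residual.AdditivePotMult.RamifiedOrdinaryLineUniquePotMult
import Summits.BirchSwinnertonDyer.Rank1Residual.AdditivePotMult.RamifiedOrdinaryLineMatchingMixed
import HarnessLib

/-!
# Inputs of the Greenberg–Vatsal transfer COUNT at EVERY ODD prime `p` on the four additive
# potentially-ordinary loci: the curve-level transfer with a line-MATCHING hypothesis, "matching under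
# every congruence ⟹ `hθL`", the Remark-(2.9) clause `h0` for EVERY ramified ordinary line (uniqueness),
# and the (G-ord, `e = 2`)² matching in the ∀-form
# (cell `b2b-bsdres`, team n1011, seat p12 (gen 5); row T-E3g-GV29o FILE 1; ROUTE-2 II.15.4 ARM α, kernel half)

HONEST FRAMING (cell `b2b-bsdres`, run/shared/lean/b2b/bsd-rank1-residual/, verbatim in every
file): the goal of the cell is to DELETE the COMBINATION-SHAPED residual classes of the
Birch–Swinnerton-Dyer formula for ALL analytic-rank `≤ 1` elliptic curves over `ℚ` — "full BSD
formula for every rank `≤ 1` curve in class `C`" assembled STRICTLY from published theorems — so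
that the rank-`≤ 1` remainder becomes exactly the CONSTRUCTION-SHAPED classes, which are TYPED
(missing-input `Prop`s), NOT attempted. This is not "finishing BSD". Team n1011: research routes on
CONSTRUCTION-SHAPED classes; prove what is provable now; no claim beyond stated classes; census
output = EVIDENCE, never a Literature fact; RESIDUAL-MAP marks UNCHANGED; nothing is booked by this
file. THEOREMS ONLY: no definition, no named fact; p07's `RamifiedOrdinaryLineMatching[Mixed]`,
p10's `GordRamifiedOrdinaryLine[Pair]`, cc-typer-2's `RamifiedOrdinaryLineUnique*` and eisenstein-p2's
`X2.GreenbergVatsalTransferCurve` are consumed BY NAME and untouched.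

## What and why

Greenberg–Vatsal p. 27: "the order of `S^{Σ₀}_{A_i[p]}(ℚ_∞)` is independent of `i` since
`A₁[p] ≅ A₂[p]`". GEN 4 (row T-E3g-GV29) proved this COUNT in the kernel at `p = 3` on (G-ord) pairs
(`GreenbergVatsalTransferCountThree`; cc-typer-1's `GreenbergVatsalTransferCountThreePotMult` for the
(M) / mixed pairs at `3`) through the I-FIXED line `C[3] = E[3]^{I}` of cc-typer-1's TB-TOL — special
to `p = 3` (`C[p]|_I = ω^{(p+1)/2}` is moved by inertia once `p ≥ 5`). At a general
odd `p` the intrinsic input is the tree's LINE MATCHING under EVERY `Γ_ℚ`-equivariant `E₁[p] ≃+ E₂[p]`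
(p07 `PotMult.exists_lines_matching`, `exists_lines_matching_of_typeGOrd_potMult`,
`exists_isRamifiedOrdinaryLine_shape_of_goodOrd_twist`; p10's mechanism: one inertia element acting as
`±2` on the line and `±1` on the quotient, the sign `χ_{p*}` being the same on both curves) together
with the UNIQUENESS of the ramified ordinary line (cc-typer-2), which carries GEN 4's Remark-(2.9)
clause `(E[p^∞]/C)^{ker κ ⊓ I_v} = 0` (`RamifiedOrdinaryLineQuotientInvariants`) onto the matched
lines. This FILE 1 supplies the inputs; FILE 2 (`GreenbergVatsalTransferCountOdd`) assembles the count.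

* §1 `GreenbergVatsalTransferRamified.natCard_gvSelmer_inf_torsion_mul_eq_curve_of_map_plus_eq` —
  the curve form of GEN 4 FILE 2's two-module transfer (any number field `K`, any `L = K̄^H`) with
  the line-MATCHING hypothesis `hθL` in place of the flipped-line hypotheses `hfix`/`hmax`;
  `Additive.map_torsionDatum_plus_eq_of_forall_matching` — over `ℚ`, matching under every equivariant
  `E₁[p] ≃+ E₂[p]` (p07's statement shape, on `geomTorsion`) gives `hθL` for every equivariant
  `θ : E₁[p^∞][p] ≃+ E₂[p^∞][p]` (eisenstein-p2's `nonempty_torsionBy_primaryTorsion_equiv`).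
* §2 `h0` FOR EVERY RAMIFIED ORDINARY LINE on the four loci (uniqueness ∘ GEN 4 FILE 4):
  `ClassX4Gord/ClassX3Gord/PotMult/ClassX4M/ClassX3M.gr_invariants_eq_zero_of_isRamifiedOrdinaryLine`;
  the (G-ord, `e = 2`)² matching in the ∀-form (p07's shape lemma on both sides):
  `GreenbergVatsalTransferCountOdd.exists_lines_matching_of_goodOrd_twists` / `…_of_typeGOrd_typeGOrd`.

NOT here: the count itself (FILE 2); the LINK `Sel = S` (T-RD); the `λ`-reading (the typed GV
record); any class theorem; nothing booked.

References: [GreenbergVatsal2000] §2 Prop. (2.8), Remark (2.9), pp. 26–27 (held text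
`paper:arxiv-math_9906215`); [EmertonPollackWeston2006] pp. 2–3, §3.1 (eq:ordes); ROUTE-2 II.15.4.
-/

set_option autoImplicit false

noncomputable section

open scoped Classical NumberField AddSubgroup

open NumberField IsDedekindDomain Field WeierstrassCurve
  Literature.NumberTheory.GaloisRepresentations Literature.NumberTheory.EllipticCurves
  Literature.NumberTheory.EllipticCurves.GreenbergSelmer
  Literature.NumberTheory.EllipticCurves.EmertonPollackWeston2006
  Literature.NumberTheory.EllipticCurves.Rank1Residual
  Summit.BirchSwinnertonDyer.Rank1Residual.X2.TorsionComparison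
  Summit.BirchSwinnertonDyer.Rank1Residual.X2.GreenbergVatsalTorsion
  Summit.BirchSwinnertonDyer.Rank1Residual.X2.GreenbergVatsalTorsionIso

universe u

/-! ## §1. The curve-level transfer with a line-MATCHING hypothesis; matching ⟹ `hθL` over `ℚ` -/

namespace Summit.BirchSwinnertonDyer.Rank1Residual.Additive.GreenbergVatsalTransferRamified

open Summit.BirchSwinnertonDyer.Rank1Residual.Additive.GreenbergVatsalTorsionRamified

section Curve

variable {K : Type u} [Field K] [NumberField K]
  (p : ℕ) [Fact p.Prime] (H : Subgroup (absoluteGaloisGroup K)) [H.Normal]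
  (W₁ : WeierstrassCurve K) [W₁.IsElliptic] (W₂ : WeierstrassCurve K) [W₂.IsElliptic]
  (L₁ : Data K (W₁.geomPrimaryTorsion p) p) (L₂ : Data K (W₂.geomPrimaryTorsion p) p)
  (S₀ : Set (HeightOneSpectrum (𝓞 K)))

/-- **GV's transfer count for two curves over a number field `K` whose Greenberg data at `v ∣ p`
MATCH under a `Γ_K`-equivariant `θ : E₁[p^∞][p] ≃+ E₂[p^∞][p]`, at RAMIFIED quotients.** Data
`C_{i,v} ⊂ E_i[p^∞]` (`v ∣ p`) `p`-divisible with `(E_i[p^∞]/C_{i,v})^{H ⊓ I_v} = 0` (Remark (2.9)),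
`E_i` good outside `S₀ ∪ {v ∣ p}`, `E_i(L)[p^∞]` finite (`L = K̄^H`), and
`θ(E₁[p] ∩ C_{1,v}) = E₂[p] ∩ C_{2,v}` for every `v ∣ p` ⟹
`#(S^{S₀}_{E₁[p^∞]}(L) ⊓ H¹[p]) · #E₁(L)[p] = #(S^{S₀}_{E₂[p^∞]}(L) ⊓ H¹[p]) · #E₂(L)[p]`. (GEN 4
FILE 2's `natCard_gvSelmer_inf_torsion_mul_eq_of_divisible_invariants` + FILE 1's
`divisible_invariants_of_invariants_eq_bot` + eisenstein-p2's curve lemmas.) NO irreducibility, NO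
image hypothesis, NO `H⁰ = 0`. [cite: GreenbergVatsal2000, §2 Prop. (2.8), Remark (2.9) and pp. 26–27] -/
theorem natCard_gvSelmer_inf_torsion_mul_eq_curve_of_map_plus_eq
    (hS₁ : ∀ v : HeightOneSpectrum (𝓞 K), v ∉ S₀ → ((p : ℕ) : 𝓞 K) ∉ v.asIdeal →
      W₁.HasGoodReductionAt v)
    (hS₂ : ∀ v : HeightOneSpectrum (𝓞 K), v ∉ S₀ → ((p : ℕ) : 𝓞 K) ∉ v.asIdeal →
      W₂.HasGoodReductionAt v)
    (hplus₁ : ∀ (v : HeightOneSpectrum (𝓞 K)) (hv : ((p : ℕ) : 𝓞 K) ∈ v.asIdeal),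
      ∀ c ∈ (L₁ v hv).plus, ∃ c' ∈ (L₁ v hv).plus, p • c' = c)
    (hplus₂ : ∀ (v : HeightOneSpectrum (𝓞 K)) (hv : ((p : ℕ) : 𝓞 K) ∈ v.asIdeal),
      ∀ c ∈ (L₂ v hv).plus, ∃ c' ∈ (L₂ v hv).plus, p • c' = c)
    (h0₁ : ∀ (v : HeightOneSpectrum (𝓞 K)) (hv : ((p : ℕ) : 𝓞 K) ∈ v.asIdeal),
      ∀ a ∈ invariants (inertiaIn H v) (L₁ v hv).Gr, a = 0)
    (h0₂ : ∀ (v : HeightOneSpectrum (𝓞 K)) (hv : ((p : ℕ) : 𝓞 K) ∈ v.asIdeal),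
      ∀ a ∈ invariants (inertiaIn H v) (L₂ v hv).Gr, a = 0)
    [hfin₁ : Finite (FixedPoints.addSubgroup H (W₁.geomPrimaryTorsion p))]
    [hfin₂ : Finite (FixedPoints.addSubgroup H (W₂.geomPrimaryTorsion p))]
    (θ : (W₁.geomPrimaryTorsion p)[(p : ℤ)] ≃+ (W₂.geomPrimaryTorsion p)[(p : ℤ)])
    (hθ : ∀ (g : absoluteGaloisGroup K) (m : (W₁.geomPrimaryTorsion p)[(p : ℤ)]),
      θ (g • m) = g • θ m)
    (hθL : ∀ (v : HeightOneSpectrum (𝓞 K)) (hv : ((p : ℕ) : 𝓞 K) ∈ v.asIdeal),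
      (torsionData L₁ p v hv).plus.map
          (θ : (W₁.geomPrimaryTorsion p)[(p : ℤ)] →+ (W₂.geomPrimaryTorsion p)[(p : ℤ)]) =
        (torsionData L₂ p v hv).plus) :
    Nat.card (gvSelmer H (W₁.geomPrimaryTorsion p) p L₁ S₀ ⊓
          (subgroupH1 H (W₁.geomPrimaryTorsion p))[(p : ℤ)] :
          AddSubgroup (subgroupH1 H (W₁.geomPrimaryTorsion p))) *
        Nat.card ((FixedPoints.addSubgroup H (W₁.geomPrimaryTorsion p))[(p : ℤ)]) =
      Nat.card (gvSelmer H (W₂.geomPrimaryTorsion p) p L₂ S₀ ⊓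
          (subgroupH1 H (W₂.geomPrimaryTorsion p))[(p : ℤ)] :
          AddSubgroup (subgroupH1 H (W₂.geomPrimaryTorsion p))) *
        Nat.card ((FixedPoints.addSubgroup H (W₂.geomPrimaryTorsion p))[(p : ℤ)]) := by
  haveI : Finite (invariants H (W₁.geomPrimaryTorsion p)) := hfin₁
  haveI : Finite (invariants H (W₂.geomPrimaryTorsion p)) := hfin₂
  exact natCard_gvSelmer_inf_torsion_mul_eq_of_divisible_invariants H
    (W₁.geomPrimaryTorsion p) (W₂.geomPrimaryTorsion p) p L₁ L₂ S₀ p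
    (X2.GreenbergVatsalTorsionCurve.continuous_smul_curve W₁ p)
    (X2.GreenbergVatsalTorsionCurve.continuous_smul_curve W₂ p)
    (X2.GreenbergVatsalTorsionCurve.divisible_curve W₁ p)
    (X2.GreenbergVatsalTorsionCurve.divisible_curve W₂ p)
    (X2.GreenbergVatsalTorsionCurve.unramified_outside W₁ p S₀ hS₁)
    (X2.GreenbergVatsalTorsionCurve.unramified_outside W₂ p S₀ hS₂) hplus₁ hplus₂
    (fun v hv ↦ divisible_invariants_of_invariants_eq_bot H (W₁.geomPrimaryTorsion p) p (L₁ v hv)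
      (h0₁ v hv))
    (fun v hv ↦ divisible_invariants_of_invariants_eq_bot H (W₂.geomPrimaryTorsion p) p (L₂ v hv)
      (h0₂ v hv)) θ hθ hθL

end Curve
end Summit.BirchSwinnertonDyer.Rank1Residual.Additive.GreenbergVatsalTransferRamified

namespace Summit.BirchSwinnertonDyer.Rank1Residual.Additive

section Matching

variable {p : ℕ} [hp : Fact p.Prime] {W₁ W₂ : WeierstrassCurve ℚ} {v : HeightOneSpectrum (𝓞 ℚ)}
  (L₁ : LocalDatum ℚ (W₁.geomPrimaryTorsion p) v) (L₂ : LocalDatum ℚ (W₂.geomPrimaryTorsion p) v)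

/-- **Matching under every equivariant `E₁[p] ≃+ E₂[p]` ⟹ `θ(E₁[p] ∩ C₁) = E₂[p] ∩ C₂` for every
equivariant `θ : E₁[p^∞][p] ≃+ E₂[p^∞][p]`** (the hypothesis `hθL` of the transfer count): transport
`θ` to `E₁[p] ≃+ E₂[p]` along eisenstein-p2's identifications `E_i[p^∞][p] ≃ E_i[p]` (same points) and
read p07's matching statement there. [cite: EmertonPollackWeston2006, pp. 2–3 and §3.1 (eq:ordes) (arXiv:math/0404484 p. 17)] -/
theorem map_torsionDatum_plus_eq_of_forall_matching
    (hmatch : ∀ e : geomTorsion W₁ (p : ℤ) ≃+ geomTorsion W₂ (p : ℤ),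
      (∀ (σ : absoluteGaloisGroup ℚ) (P : geomTorsion W₁ (p : ℤ)), e (σ • P) = σ • e P) →
      ∀ P : geomTorsion W₁ (p : ℤ),
        AddSubgroup.inclusion (geomTorsion_le_geomPrimaryTorsion W₁ p) P ∈ L₁.plus ↔
          AddSubgroup.inclusion (geomTorsion_le_geomPrimaryTorsion W₂ p) (e P) ∈ L₂.plus)
    (θ : (W₁.geomPrimaryTorsion p)[(p : ℤ)] ≃+ (W₂.geomPrimaryTorsion p)[(p : ℤ)])
    (hθ : ∀ (g : absoluteGaloisGroup ℚ) (m : (W₁.geomPrimaryTorsion p)[(p : ℤ)]),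
      θ (g • m) = g • θ m) :
    (torsionDatum L₁ p).plus.map
        (θ : (W₁.geomPrimaryTorsion p)[(p : ℤ)] →+ (W₂.geomPrimaryTorsion p)[(p : ℤ)]) =
      (torsionDatum L₂ p).plus := by
  obtain ⟨j₁, hj₁g, hj₁s⟩ := X2.GreenbergVatsalTransferCurve.nonempty_torsionBy_primaryTorsion_equiv W₁ p
  obtain ⟨j₂, hj₂g, hj₂s⟩ := X2.GreenbergVatsalTransferCurve.nonempty_torsionBy_primaryTorsion_equiv W₂ p
  have hincl₁ : ∀ x : (W₁.geomPrimaryTorsion p)[(p : ℤ)],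
      AddSubgroup.inclusion (geomTorsion_le_geomPrimaryTorsion W₁ p) (j₁ x) =
        (x : W₁.geomPrimaryTorsion p) := fun x ↦ Subtype.ext (by
    rw [AddSubgroup.coe_inclusion]
    have h := hj₁s (j₁ x)
    rw [j₁.symm_apply_apply] at h
    exact h.symm)
  have hincl₂ : ∀ x : (W₂.geomPrimaryTorsion p)[(p : ℤ)],
      AddSubgroup.inclusion (geomTorsion_le_geomPrimaryTorsion W₂ p) (j₂ x) =
        (x : W₂.geomPrimaryTorsion p) := fun x ↦ Subtype.ext (by
    rw [AddSubgroup.coe_inclusion]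
    have h := hj₂s (j₂ x)
    rw [j₂.symm_apply_apply] at h
    exact h.symm)
  have hj₁' : ∀ (g : absoluteGaloisGroup ℚ) (y : W₁.geomTorsion (p : ℤ)),
      j₁.symm (g • y) = g • j₁.symm y := by
    intro g y
    apply j₁.injective
    rw [j₁.apply_symm_apply]
    apply Subtype.ext
    rw [hj₁g g (j₁.symm y), j₁.apply_symm_apply]
    rfl
  have hj₂' : ∀ (g : absoluteGaloisGroup ℚ) (x : (W₂.geomPrimaryTorsion p)[(p : ℤ)]),
      j₂ (g • x) = g • j₂ x := fun g x ↦ Subtype.ext (hj₂g g x)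
  set e : geomTorsion W₁ (p : ℤ) ≃+ geomTorsion W₂ (p : ℤ) := j₁.symm.trans (θ.trans j₂) with hedef
  have he : ∀ (σ : absoluteGaloisGroup ℚ) (P : geomTorsion W₁ (p : ℤ)), e (σ • P) = σ • e P := by
    intro σ P
    simp only [hedef, AddEquiv.trans_apply]
    rw [hj₁', hθ, hj₂']
  have key := hmatch e he
  ext c
  simp only [AddSubgroup.mem_map, AddMonoidHom.coe_coe]
  constructor
  · rintro ⟨c₁, hc₁, rfl⟩
    have hP : AddSubgroup.inclusion (geomTorsion_le_geomPrimaryTorsion W₁ p) (j₁ c₁) ∈ L₁.plus := by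
      rw [hincl₁]; exact (AddSubgroup.mem_addSubgroupOf).1 hc₁
    have h := (key (j₁ c₁)).1 hP
    have heP : e (j₁ c₁) = j₂ (θ c₁) := by
      simp only [hedef, AddEquiv.trans_apply, j₁.symm_apply_apply]
    rw [heP, hincl₂] at h
    exact (AddSubgroup.mem_addSubgroupOf).2 h
  · intro hc
    refine ⟨θ.symm c, ?_, θ.apply_symm_apply c⟩
    have heP : e (j₁ (θ.symm c)) = j₂ c := by
      simp only [hedef, AddEquiv.trans_apply, j₁.symm_apply_apply, θ.apply_symm_apply]
    have h2 : AddSubgroup.inclusion (geomTorsion_le_geomPrimaryTorsion W₂ p) (e (j₁ (θ.symm c))) ∈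
        L₂.plus := by
      rw [heP, hincl₂]; exact (AddSubgroup.mem_addSubgroupOf).1 hc
    have h := (key (j₁ (θ.symm c))).2 h2
    rw [hincl₁] at h
    exact (AddSubgroup.mem_addSubgroupOf).2 h

end Matching
end Summit.BirchSwinnertonDyer.Rank1Residual.Additive

/-! ## §2. `h0` for EVERY ramified ordinary line on the four loci; the (G-ord, `e = 2`)² matching -/

namespace Summit.BirchSwinnertonDyer.Rank1Residual.Additive

section H0Gord

variable {p : ℕ} [hp : Fact p.Prime] (κ : ZpExtension ℚ p) {W : WeierstrassCurve ℚ} [W.IsElliptic]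
  [W.IsGloballyMinimal] {v : HeightOneSpectrum (𝓞 ℚ)}

/-- **X4♯(G-ord, `e = 2`): `(E[p^∞]/C)^{ker κ ⊓ I_v} = 0` for EVERY ramified ordinary line `C` at
`v ∋ p`** (any `ℤ_p`-extension `κ`): GEN 4's line with this property
(`ClassX4Gord.exists_isRamifiedOrdinaryLine_gr_invariants_eq_zero`) IS the given one by cc-typer-2's
uniqueness `ClassX4Gord.eq_of_isRamifiedOrdinaryLine`. [cite: GreenbergVatsal2000, §2 Remark (2.9)]
[cite: EmertonPollackWeston2006, §3.1 (eq:ordes) (arXiv:math/0404484 p. 17)] -/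
theorem ClassX4Gord.gr_invariants_eq_zero_of_isRamifiedOrdinaryLine (hX : ClassX4Gord W p)
    (he : semistabilityIndex W p = 2) (hpv : ((p : ℕ) : 𝓞 ℚ) ∈ v.asIdeal)
    {L : LocalDatum ℚ (W.geomPrimaryTorsion p) v} (hL : IsRamifiedOrdinaryLine W p L) :
    ∀ a ∈ invariants (inertiaIn κ.kerSubgroup v) L.Gr, a = 0 := by
  obtain ⟨L', hL', h0⟩ := ClassX4Gord.exists_isRamifiedOrdinaryLine_gr_invariants_eq_zero κ hX he hpv
  rw [ClassX4Gord.eq_of_isRamifiedOrdinaryLine hX he hpv hL hL']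
  exact h0

/-- **X3♯(G-ord, `e = 2`), odd `p` (REDUCIBLE `E[p]`): `(E[p^∞]/C)^{ker κ ⊓ I_v} = 0` for EVERY
ramified ordinary line `C` at `v ∋ p`.** [cite: GreenbergVatsal2000, §2 Remark (2.9)]
[cite: EmertonPollackWeston2006, §3.1 (eq:ordes) (arXiv:math/0404484 p. 17)] -/
theorem ClassX3Gord.gr_invariants_eq_zero_of_isRamifiedOrdinaryLine (hp2 : p ≠ 2)
    (hX : ClassX3Gord W p) (he : semistabilityIndex W p = 2) (hpv : ((p : ℕ) : 𝓞 ℚ) ∈ v.asIdeal)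
    {L : LocalDatum ℚ (W.geomPrimaryTorsion p) v} (hL : IsRamifiedOrdinaryLine W p L) :
    ∀ a ∈ invariants (inertiaIn κ.kerSubgroup v) L.Gr, a = 0 := by
  obtain ⟨L', hL', h0⟩ :=
    ClassX3Gord.exists_isRamifiedOrdinaryLine_gr_invariants_eq_zero κ hp2 hX he hpv
  rw [ClassX3Gord.eq_of_isRamifiedOrdinaryLine hp2 hX he hpv hL hL']
  exact h0

end H0Gord

end Summit.BirchSwinnertonDyer.Rank1Residual.Additive

namespace Summit.BirchSwinnertonDyer.Rank1Residual.AdditivePotMult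

section H0PotMult

variable {p : ℕ} [hp : Fact p.Prime] (κ : ZpExtension ℚ p) {W : WeierstrassCurve ℚ} [W.IsElliptic]
  {v : HeightOneSpectrum (𝓞 ℚ)}

/-- **pot-mult(p), odd `p`: `(E[p^∞]/C)^{ker κ ⊓ I_v} = 0` for EVERY ramified ordinary line `C` at
`v ∋ p`** (mod A40/A41): GEN 4's line (`PotMult.exists_isRamifiedOrdinaryLine_gr_invariants_eq_zero`)
IS the given one by cc-typer-2's `PotMult.eq_of_isRamifiedOrdinaryLine`.
[cite: GreenbergVatsal2000, §2 Remark (2.9)] [cite: SilvermanATAEC1994, Ch. V Thm. 5.3, Cor. 5.4] -/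
theorem PotMult.gr_invariants_eq_zero_of_isRamifiedOrdinaryLine
    (hT40 : Silverman1994_thmV53_tateUniformisation.{0})
    (hT41 : Silverman1994_thmV53_corV54_tateUniformisation.{0}) (hpm : PotMult W p) (hp2 : p ≠ 2)
    (hv : ((p : ℕ) : 𝓞 ℚ) ∈ v.asIdeal)
    {L : LocalDatum ℚ (W.geomPrimaryTorsion p) v} (hL : IsRamifiedOrdinaryLine W p L) :
    ∀ a ∈ invariants (inertiaIn κ.kerSubgroup v) L.Gr, a = 0 := by
  obtain ⟨L', hL', h0⟩ := hpm.exists_isRamifiedOrdinaryLine_gr_invariants_eq_zero κ hT40 hT41 hp2 hv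
  rw [hpm.eq_of_isRamifiedOrdinaryLine hT40 hT41 hp2 hv hL hL']
  exact h0

/-- **X4(M), odd `p`: `h0` for EVERY ramified ordinary line** (mod A40/A41).
[cite: GreenbergVatsal2000, §2 Remark (2.9)] [cite: SilvermanATAEC1994, Ch. V Thm. 5.3, Cor. 5.4] -/
theorem ClassX4M.gr_invariants_eq_zero_of_isRamifiedOrdinaryLine
    (hT40 : Silverman1994_thmV53_tateUniformisation.{0})
    (hT41 : Silverman1994_thmV53_corV54_tateUniformisation.{0}) (hX : ClassX4M W p)
    (hv : ((p : ℕ) : 𝓞 ℚ) ∈ v.asIdeal)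
    {L : LocalDatum ℚ (W.geomPrimaryTorsion p) v} (hL : IsRamifiedOrdinaryLine W p L) :
    ∀ a ∈ invariants (inertiaIn κ.kerSubgroup v) L.Gr, a = 0 :=
  (ClassX4M.potMult W p hX).gr_invariants_eq_zero_of_isRamifiedOrdinaryLine κ hT40 hT41 hX.p_ne_two
    hv hL

/-- **X3♯(M), odd `p`: `h0` for EVERY ramified ordinary line** (mod A40/A41).
[cite: GreenbergVatsal2000, §2 Remark (2.9)] [cite: SilvermanATAEC1994, Ch. V Thm. 5.3, Cor. 5.4] -/
theorem ClassX3M.gr_invariants_eq_zero_of_isRamifiedOrdinaryLine [W.IsGloballyMinimal]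
    (hT40 : Silverman1994_thmV53_tateUniformisation.{0})
    (hT41 : Silverman1994_thmV53_corV54_tateUniformisation.{0}) (hX : ClassX3M W p)
    (hv : ((p : ℕ) : 𝓞 ℚ) ∈ v.asIdeal)
    {L : LocalDatum ℚ (W.geomPrimaryTorsion p) v} (hL : IsRamifiedOrdinaryLine W p L) :
    ∀ a ∈ invariants (inertiaIn κ.kerSubgroup v) L.Gr, a = 0 :=
  (ClassX3M.potMult W p hX).gr_invariants_eq_zero_of_isRamifiedOrdinaryLine κ hT40 hT41
    (ClassX3M.p_ne_two W p hX) hv hL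

end H0PotMult

namespace GreenbergVatsalTransferCountOdd

open Summit.BirchSwinnertonDyer.Rank1Residual.Additive RamifiedOrdinaryLineMatchingMixed
  RamifiedOrdinaryLinePotMult

section GordPair

variable (V V₁ : WeierstrassCurve ℚ) [V.IsGloballyMinimal] [V.IsElliptic] [V₁.IsGloballyMinimal]
  [V₁.IsElliptic] (K : Type) [Field K] [NumberField K] (h2 : Module.finrank ℚ K = 2) {θ : K} {c : ℚ}
  (hθ : θ ∉ Set.range (algebraMap ℚ K)) (hc : θ ^ 2 = algebraMap ℚ K c) (p : ℕ) [hp : Fact p.Prime]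
  {W W₁ : WeierstrassCurve ℚ} {C C₁ : VariableChange ℚ} (hC : C • V.quadraticTwist c = W)
  (hC₁ : C₁ • V₁.quadraticTwist c = W₁)

include h2 hθ hc hC hC₁ in
/-- **(G-ord) twist × (G-ord) twist by the same `c` (`ord_v c = 1`), odd `p`: ramified ordinary lines
that MATCH under EVERY `Γ_ℚ`-equivariant `W[p] ≃+ W₁[p]`** — the ∀-form of p10's
`exists_epwLineData_of_goodOrd_model_twist`, by p07's mechanism: direction `W → W₁` at the inertia
element `σ₀` of `W`'s shape lemma (acting as `±2` on `L[p]`, as `±1` on `W₁[p^∞]/L₁`), direction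
`W₁ → W` at `σ₁` of `W₁`'s, the sign being read on the SAME `galRange ℚ(θ)`, `θ² = c`.
[cite: EmertonPollackWeston2006, pp. 2–3 and §3.1 (eq:ordes) (arXiv:math/0404484 p. 17)]
[cite: GreenbergVatsal2000, §2 p. 26] -/
theorem exists_lines_matching_of_goodOrd_twists (hp2 : p ≠ 2)
    (hΔ : ¬ (p : ℤ) ∣ minimalDiscriminantInt V) (hord : ¬ (p : ℤ) ∣ V.frobeniusTrace p)
    (hΔ₁ : ¬ (p : ℤ) ∣ minimalDiscriminantInt V₁) (hord₁ : ¬ (p : ℤ) ∣ V₁.frobeniusTrace p)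
    {v : HeightOneSpectrum (𝓞 ℚ)} (hv : ((p : ℕ) : 𝓞 ℚ) ∈ v.asIdeal)
    (hval : v.valuation ℚ c = WithZero.exp (-1 : ℤ)) :
    ∃ (L : LocalDatum ℚ (W.geomPrimaryTorsion p) v) (L₁ : LocalDatum ℚ (W₁.geomPrimaryTorsion p) v),
      IsRamifiedOrdinaryLine W p L ∧ IsRamifiedOrdinaryLine W₁ p L₁ ∧
      ∀ e : geomTorsion W (p : ℤ) ≃+ geomTorsion W₁ (p : ℤ),
        (∀ (σ : absoluteGaloisGroup ℚ) (P : geomTorsion W (p : ℤ)), e (σ • P) = σ • e P) →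
        ∀ P : geomTorsion W (p : ℤ),
          AddSubgroup.inclusion (geomTorsion_le_geomPrimaryTorsion W p) P ∈ L.plus ↔
            AddSubgroup.inclusion (geomTorsion_le_geomPrimaryTorsion W₁ p) (e P) ∈ L₁.plus := by
  obtain ⟨L, hL, hqL, σ₀, hσ₀, hlL⟩ :=
    exists_isRamifiedOrdinaryLine_shape_of_goodOrd_twist V K h2 hθ hc p hC hp2 hv hval hΔ hord
  obtain ⟨L₁, hL₁, hqL₁, σ₁, hσ₁, hlL₁⟩ :=
    exists_isRamifiedOrdinaryLine_shape_of_goodOrd_twist V₁ K h2 hθ hc p hC₁ hp2 hv hval hΔ₁ hord₁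
  refine ⟨L, L₁, hL, hL₁, fun e he P ↦ ⟨fun hP ↦ ?_, fun hP ↦ ?_⟩⟩
  · by_cases hg : absGaloisRestrict ℚ (v.adicCompletion ℚ) σ₀ ∈ galRange (K := ℚ) K
    · exact RamifiedOrdinaryLineMatching.inclusion_apply_mem_of_pos L L₁ e he
        (fun m hm hpm ↦ (hlL m hm hpm).1 hg) ((hqL₁ σ₀ hσ₀).1 hg) P hP
    · exact RamifiedOrdinaryLineMatching.inclusion_apply_mem_of_neg L L₁ e he
        (fun m hm hpm ↦ (hlL m hm hpm).2 hg) ((hqL₁ σ₀ hσ₀).2 hg) P hP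
  · have he' := RamifiedOrdinaryLineMatching.symm_smul e he
    have key : AddSubgroup.inclusion (geomTorsion_le_geomPrimaryTorsion W p) (e.symm (e P)) ∈
        L.plus := by
      by_cases hg : absGaloisRestrict ℚ (v.adicCompletion ℚ) σ₁ ∈ galRange (K := ℚ) K
      · exact RamifiedOrdinaryLineMatching.inclusion_apply_mem_of_pos L₁ L e.symm he'
          (fun m hm hpm ↦ (hlL₁ m hm hpm).1 hg) ((hqL σ₁ hσ₁).1 hg) (e P) hP
      · exact RamifiedOrdinaryLineMatching.inclusion_apply_mem_of_neg L₁ L e.symm he'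
          (fun m hm hpm ↦ (hlL₁ m hm hpm).2 hg) ((hqL σ₁ hσ₁).2 hg) (e P) hP
    rwa [e.symm_apply_apply] at key

end GordPair

section GordClasses

variable {W W₁ : WeierstrassCurve ℚ} [W.IsElliptic] [W.IsGloballyMinimal] [W₁.IsElliptic]
  [W₁.IsGloballyMinimal] {p : ℕ} [hp : Fact p.Prime]

/-- **(G-ord, `e = 2`) × (G-ord, `e = 2`) at the same odd `p` (`p = 3` included): ramified ordinary
lines that match under EVERY congruence** (`p*`-twist models of both:
`TypeGOrd.exists_goodOrd_pStar_twist_model`; UNCONDITIONAL — no Tate facts on this locus).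
[cite: EmertonPollackWeston2006, pp. 2–3 and §3.1 (eq:ordes) (arXiv:math/0404484 p. 17)] [cite: GreenbergVatsal2000, §2 p. 26] -/
theorem exists_lines_matching_of_typeGOrd_typeGOrd (hp2 : p ≠ 2)
    (hG : TypeGOrd W p) (hadd : Addv W p) (he2 : semistabilityIndex W p = 2)
    (hG₁ : TypeGOrd W₁ p) (hadd₁ : Addv W₁ p) (he2₁ : semistabilityIndex W₁ p = 2)
    {v : HeightOneSpectrum (𝓞 ℚ)} (hv : ((p : ℕ) : 𝓞 ℚ) ∈ v.asIdeal) :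
    ∃ (L : LocalDatum ℚ (W.geomPrimaryTorsion p) v) (L₁ : LocalDatum ℚ (W₁.geomPrimaryTorsion p) v),
      IsRamifiedOrdinaryLine W p L ∧ IsRamifiedOrdinaryLine W₁ p L₁ ∧
      ∀ e : geomTorsion W (p : ℤ) ≃+ geomTorsion W₁ (p : ℤ),
        (∀ (σ : absoluteGaloisGroup ℚ) (P : geomTorsion W (p : ℤ)), e (σ • P) = σ • e P) →
        ∀ P : geomTorsion W (p : ℤ),
          AddSubgroup.inclusion (geomTorsion_le_geomPrimaryTorsion W p) P ∈ L.plus ↔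
            AddSubgroup.inclusion (geomTorsion_le_geomPrimaryTorsion W₁ p) (e P) ∈ L₁.plus := by
  obtain ⟨V, _, _, C, hV, hC⟩ := TypeGOrd.exists_goodOrd_pStar_twist_model W p hp2 hG hadd he2
  obtain ⟨V₁, _, _, C₁, hV₁, hC₁⟩ := TypeGOrd.exists_goodOrd_pStar_twist_model W₁ p hp2 hG₁ hadd₁ he2₁
  obtain ⟨K, _, _, hK2, θ, hθ, hθ2⟩ := RamifiedOrdinaryLinePotMult.exists_numberField_sq_eq_pStar hp2
  exact exists_lines_matching_of_goodOrd_twists V V₁ K hK2 hθ hθ2 p hC hC₁ hp2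
    (V.not_dvd_minimalDiscriminantInt_of_hasGoodReductionAtPrime' p hV.1) hV.2
    (V₁.not_dvd_minimalDiscriminantInt_of_hasGoodReductionAtPrime' p hV₁.1) hV₁.2 hv
    (RamifiedOrdinaryLinePotMult.valuation_pStar p v hv)

end GordClasses
end GreenbergVatsalTransferCountOdd
end Summit.BirchSwinnertonDyer.Rank1Residual.AdditivePotMult

end
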